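import Summits.Ventures.QEC.Census.CertBZPlane
import Summits.Ventures.QEC.Census.TwoBGA.A2h_n240_k16_77e10a56.Cert
import Summits.Ventures.QEC.Census.TwoBGA.A2h_n240_k16_77e10a56.OrbitZ
import Summits.Ventures.QEC.Census.TwoBGA.A2h_n240_k16_77e10a56.OrbitX
import HarnessLib

/-!
# `A2h_n240_k16_77e10a56` — lane-engine replays, part 1/12 (census row `A2h_n240_k16_77e10a56`; qec-search-4 orbit lane, emitted by qec-type-08 g7)

`Plane.segOK` verdicts (type-01 lane engine, `decide +kernel`) for segments of the kernel-basis replays of the views of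
`Census/TwoBGA/A2h_n240_k16_77e10a56/`; assembled in `Distance.lean`.  Generated by `tools/gen4/emit_orbit_row.py`; do not edit by hand.
-/

set_option autoImplicit false
set_option Elab.async false

namespace Summit.Ventures.QEC.Census.A2h_n240_k16_77e10a56

open Summit.Ventures.QEC.Census

set_option maxHeartbeats 400000000 in
/-- `Z` view 0, lane segment `[0, 60)` (5985197 lanes, depth 5, threshold 11; est 42 s): every selection with largest row there passes (lane engine, KERNEL). -/
theorem psegZ_0_0 : Plane.segOK 240 11 (A2h_n240_k16_77e10a56.cert.sideZ.found.map Prod.fst) A2h_n240_k16_77e10a56.pGZ_0 5 0 60 40 = true := by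
  decide +kernel

set_option maxHeartbeats 400000000 in
/-- `Z` view 0, lane segment `[60, 69)` (6172626 lanes, depth 5, threshold 11; est 26 s): every selection with largest row there passes (lane engine, KERNEL). -/
theorem psegZ_0_1 : Plane.segOK 240 11 (A2h_n240_k16_77e10a56.cert.sideZ.found.map Prod.fst) A2h_n240_k16_77e10a56.pGZ_0 5 60 9 40 = true := by
  decide +kernel

set_option maxHeartbeats 400000000 in
/-- `Z` view 0, lane segment `[69, 75)` (6387392 lanes, depth 5, threshold 11; est 43 s): every selection with largest row there passes (lane engine, KERNEL). -/
theorem psegZ_0_2 : Plane.segOK 240 11 (A2h_n240_k16_77e10a56.cert.sideZ.found.map Prod.fst) A2h_n240_k16_77e10a56.pGZ_0 5 69 6 40 = true := by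
  decide +kernel

set_option maxHeartbeats 400000000 in
/-- `Z` view 0, lane segment `[75, 79)` (5577040 lanes, depth 5, threshold 11; est 28 s): every selection with largest row there passes (lane engine, KERNEL). -/
theorem psegZ_0_3 : Plane.segOK 240 11 (A2h_n240_k16_77e10a56.cert.sideZ.found.map Prod.fst) A2h_n240_k16_77e10a56.pGZ_0 5 75 4 40 = true := by
  decide +kernel

set_option maxHeartbeats 400000000 in
/-- `Z` view 0, lane segment `[79, 82)` (5004104 lanes, depth 5, threshold 11; est 22 s): every selection with largest row there passes (lane engine, KERNEL). -/
theorem psegZ_0_4 : Plane.segOK 240 11 (A2h_n240_k16_77e10a56.cert.sideZ.found.map Prod.fst) A2h_n240_k16_77e10a56.pGZ_0 5 79 3 40 = true := by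
  decide +kernel

set_option maxHeartbeats 400000000 in
/-- `Z` view 0, lane segment `[82, 85)` (5802368 lanes, depth 5, threshold 11; est 18 s): every selection with largest row there passes (lane engine, KERNEL). -/
theorem psegZ_0_5 : Plane.segOK 240 11 (A2h_n240_k16_77e10a56.cert.sideZ.found.map Prod.fst) A2h_n240_k16_77e10a56.pGZ_0 5 82 3 40 = true := by
  decide +kernel

set_option maxHeartbeats 400000000 in
/-- `Z` view 0, lane segment `[85, 87)` (4356848 lanes, depth 5, threshold 11; est 15 s): every selection with largest row there passes (lane engine, KERNEL). -/
theorem psegZ_0_6 : Plane.segOK 240 11 (A2h_n240_k16_77e10a56.cert.sideZ.found.map Prod.fst) A2h_n240_k16_77e10a56.pGZ_0 5 85 2 40 = true := by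
  decide +kernel

end Summit.Ventures.QEC.Census.A2h_n240_k16_77e10a56
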